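import Summits.QuantumFields.YangMills.Theorems.RationalShortRootRigidityMobiusTopForm
import Summits.QuantumFields.YangMills.Theorems.RationalShortRootRigidityHyperplaneVanishing
import HarnessLib

/-!
# `RationalShortRootRigidity` — Step 4 helper (m15): `W(F₄)`-invariant quartics and `W(B₄)`-invariant quadratics are radial

Helper lemma INSIDE the paper proof of crux `stmt-QuantumFields-23124` (`F4SubCurvatureDoor.RationalShortRootRigidity`,
LINE g15-A of planner ym-idea-3; Step 4 = `stub_alternation`, Chevalley-free plan HOME l15/STUB-PLAN-Alternation.md — the ONLY place
where the half-reflection enters; free-hands menu V, item (m15), statement typed in HOME l15/Helpers23124d.lean as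
`Helpers.QuarticF4Radial` — proved here DEF-FREE, with `IsB4Inv'` / `IsHalfInv'` unfolded to their bodies):

**Lemma** (`quarticF4Radial`).  (a) A homogeneous quartic `Z ∈ ℝ[p₀,…,p₃]` invariant under the signed permutations `W(B₄)` and under
the half-reflection `p ↦ p − ½(Σpⱼ)(1,1,1,1)` is `c·(Σpᵢ²)²`.  (b) A homogeneous quadratic invariant under `W(B₄)` is `c·Σpᵢ²`.

Proof (coefficients, no invariant theory).  Sign changes kill every monomial with an odd exponent (`coeff_eq_zero_of_odd`);
permutations equalise coefficients along orbits (`coeff_mapDomain_perm`); an all-even exponent of degree `2` is `pᵢ²`, of degree `4` is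
`pᵢ⁴` or `pᵢ²pⱼ²` (`i ≠ j`).  Subtracting `c·(Σpᵢ²)^{1,2}` with `c` the `p₀^{2,4}`-coefficient (`= Z(e₀)`, `eval_e0_eq_coeff`) leaves `W`
with vanishing pure coefficients; in degree `2` nothing else remains, in degree `4` all mixed coefficients equal one number `β`, and if
`β ≠ 0` then `W(s e₀) = (1/16)·W(1,1,1,1) = (1/16)·β·#supp W ≠ 0 = W(e₀)` contradicts the half-reflection invariance.

Mathlib + tree helpers (`eval_smul_of_isHomogeneous` p665007, `eval_bind₁_gen` p665739); THEOREMS ONLY (no definitions); no named facts;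
no `sorry`; default heartbeats.  Nothing about the crux 23124, the route's rung or the Yang–Mills mass gap is proved here.  Free-hands
seat `ym-line-frs-p2` g10, `--supports stmt-QuantumFields-23124`.
-/

set_option autoImplicit false

namespace Summit.QuantumFields.YangMills.Theorems.RationalShortRootRigidity

open scoped BigOperators

/-! ## 1. Coefficient bookkeeping for signed permutations -/

/-- Rescaling the variables multiplies each coefficient by the corresponding monomial in the scaling factors. [folklore] -/
theorem coeff_bind₁_rescale (Z : MvPolynomial (Fin 4) ℝ) (ε : Fin 4 → ℝ) (d : Fin 4 →₀ ℕ) :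
    MvPolynomial.coeff d (MvPolynomial.bind₁ (fun j => MvPolynomial.C (ε j) * MvPolynomial.X j) Z) =
      (∏ j ∈ d.support, ε j ^ d j) * MvPolynomial.coeff d Z := by
  classical
  have hmon : ∀ (e : Fin 4 →₀ ℕ) (a : ℝ),
      MvPolynomial.bind₁ (fun j => MvPolynomial.C (ε j) * MvPolynomial.X j) (MvPolynomial.monomial e a) =
        MvPolynomial.monomial e ((∏ j ∈ e.support, ε j ^ e j) * a) := by
    intro e a
    rw [MvPolynomial.bind₁_monomial, MvPolynomial.monomial_eq, Finsupp.prod]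
    simp only [mul_pow, Finset.prod_mul_distrib, ← map_pow, ← map_prod]
    rw [map_mul]; ring
  conv_lhs => rw [Z.as_sum, map_sum]
  simp_rw [hmon]
  rw [MvPolynomial.coeff_sum, Finset.sum_eq_single d]
  · rw [MvPolynomial.coeff_monomial, if_pos rfl]
  · intro e _ hne; rw [MvPolynomial.coeff_monomial, if_neg hne]
  · intro hd
    rw [MvPolynomial.coeff_monomial, if_pos rfl, MvPolynomial.notMem_support_iff.1 hd, mul_zero]

/-- Sign changes kill monomials with an odd exponent. [folklore] -/
theorem coeff_eq_zero_of_odd (Z : MvPolynomial (Fin 4) ℝ)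
    (hflip : ∀ ε : Fin 4 → ℝ, (∀ i, ε i = 1 ∨ ε i = -1) →
      ∀ p : Fin 4 → ℝ, MvPolynomial.eval (fun i => ε i * p i) Z = MvPolynomial.eval p Z)
    (d : Fin 4 →₀ ℕ) (i : Fin 4) (hi : Odd (d i)) : MvPolynomial.coeff d Z = 0 := by
  classical
  set ε : Fin 4 → ℝ := Function.update (fun _ => (1 : ℝ)) i (-1) with hε
  have hε1 : ∀ j, ε j = 1 ∨ ε j = -1 := by
    intro j; by_cases hj : j = i
    · right; rw [hε, hj, Function.update_self]
    · left; rw [hε, Function.update_of_ne hj]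
  have hbind : MvPolynomial.bind₁ (fun j => MvPolynomial.C (ε j) * MvPolynomial.X j) Z = Z := by
    apply MvPolynomial.funext
    intro v
    rw [eval_bind₁_gen]
    have hpt : (fun j => MvPolynomial.eval v (MvPolynomial.C (ε j) * MvPolynomial.X j)) = fun j => ε j * v j := by
      funext j; rw [map_mul, MvPolynomial.eval_C, MvPolynomial.eval_X]
    rw [hpt]
    exact hflip ε hε1 v
  have h1 := coeff_bind₁_rescale Z ε d
  rw [hbind] at h1
  have hprod : ∏ j ∈ d.support, ε j ^ d j = -1 := by
    have hmem : i ∈ d.support := Finsupp.mem_support_iff.2 (Nat.pos_of_ne_zero (fun h => by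
      rw [h] at hi; exact absurd hi (by decide))).ne'
    rw [← Finset.mul_prod_erase _ _ hmem, hε, Function.update_self, hi.neg_one_pow]
    rw [Finset.prod_eq_one fun j hj => ?_]
    · ring
    · rw [Function.update_of_ne (Finset.ne_of_mem_erase hj), one_pow]
  rw [hprod] at h1
  linarith

/-- Permutations of the variables preserve coefficients along orbits. [folklore] -/
theorem coeff_mapDomain_perm (Z : MvPolynomial (Fin 4) ℝ)
    (hperm : ∀ σ : Equiv.Perm (Fin 4), ∀ p : Fin 4 → ℝ, MvPolynomial.eval (fun i => p (σ i)) Z = MvPolynomial.eval p Z)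
    (σ : Equiv.Perm (Fin 4)) (d : Fin 4 →₀ ℕ) :
    MvPolynomial.coeff (Finsupp.mapDomain σ d) Z = MvPolynomial.coeff d Z := by
  have hren : MvPolynomial.rename σ Z = Z := by
    apply MvPolynomial.funext
    intro v
    rw [MvPolynomial.eval_rename]
    exact hperm σ v
  conv_lhs => rw [← hren]
  exact MvPolynomial.coeff_rename_mapDomain σ σ.injective Z d

/-! ## 2. Exponents of degree `2` and `4` with even entries -/

/-- An all-even exponent of degree `2` in four variables is `pᵢ²`. [folklore] -/
theorem exists_single_two (d : Fin 4 →₀ ℕ) (heven : ∀ i, Even (d i)) (hdeg : d.degree = 2) :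
    ∃ i, d = Finsupp.single i 2 := by
  classical
  rw [Finsupp.degree_eq_sum] at hdeg
  have hne : ∃ i, d i ≠ 0 := by
    by_contra h
    have h0 : ∀ i, d i = 0 := fun i => not_not.1 fun hi => h ⟨i, hi⟩
    simp only [h0, Finset.sum_const_zero] at hdeg
    omega
  obtain ⟨i, hi⟩ := hne
  have hsplit := Finset.add_sum_erase Finset.univ (fun l => d l) (Finset.mem_univ i)
  rw [hdeg] at hsplit
  have hi2 : 2 ≤ d i := by obtain ⟨r, hr⟩ := heven i; omega
  have hrest : ∑ l ∈ Finset.univ.erase i, d l = 0 := by omega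
  have hdi : d i = 2 := by omega
  rw [Finset.sum_eq_zero_iff] at hrest
  refine ⟨i, Finsupp.ext fun j => ?_⟩
  by_cases hj : j = i
  · rw [hj, Finsupp.single_eq_same, hdi]
  · rw [Finsupp.single_eq_of_ne hj]
    exact hrest j (Finset.mem_erase.2 ⟨hj, Finset.mem_univ j⟩)

/-- An all-even exponent of degree `4` in four variables is `pᵢ⁴` or `pᵢ²pⱼ²` (`i ≠ j`). [folklore] -/
theorem shape_even_four (d : Fin 4 →₀ ℕ) (heven : ∀ i, Even (d i)) (hdeg : d.degree = 4) :
    (∃ i, d = Finsupp.single i 4) ∨ (∃ i j, i ≠ j ∧ d = Finsupp.single i 2 + Finsupp.single j 2) := by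
  classical
  rw [Finsupp.degree_eq_sum] at hdeg
  have hne : ∃ i, d i ≠ 0 := by
    by_contra h
    have h0 : ∀ i, d i = 0 := fun i => not_not.1 fun hi => h ⟨i, hi⟩
    simp only [h0, Finset.sum_const_zero] at hdeg
    omega
  obtain ⟨i, hi⟩ := hne
  have hsplit := Finset.add_sum_erase Finset.univ (fun l => d l) (Finset.mem_univ i)
  rw [hdeg] at hsplit
  have hi24 : d i = 2 ∨ d i = 4 := by obtain ⟨r, hr⟩ := heven i; omega
  rcases hi24 with hdi | hdi
  · -- a second non-zero entry
    right
    have hrest : ∑ l ∈ Finset.univ.erase i, d l = 2 := by omega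
    have hne' : ∃ j ∈ Finset.univ.erase i, d j ≠ 0 := by
      by_contra h
      have h0 : ∀ j ∈ Finset.univ.erase i, d j = 0 := fun j hj => not_not.1 fun hj' => h ⟨j, hj, hj'⟩
      rw [Finset.sum_eq_zero h0] at hrest
      omega
    obtain ⟨j, hj, hj0⟩ := hne'
    have hji : j ≠ i := Finset.ne_of_mem_erase hj
    have hsplit' := Finset.add_sum_erase (Finset.univ.erase i) (fun l => d l) hj
    rw [hrest] at hsplit'
    have hj2 : 2 ≤ d j := by obtain ⟨r, hr⟩ := heven j; omega
    have hrest' : ∑ l ∈ (Finset.univ.erase i).erase j, d l = 0 := by omega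
    have hdj : d j = 2 := by omega
    rw [Finset.sum_eq_zero_iff] at hrest'
    refine ⟨i, j, hji.symm, Finsupp.ext fun l => ?_⟩
    rw [Finsupp.add_apply]
    by_cases hli : l = i
    · rw [hli, Finsupp.single_eq_same, Finsupp.single_eq_of_ne hji.symm, hdi, add_zero]
    · by_cases hlj : l = j
      · rw [hlj, Finsupp.single_eq_same, Finsupp.single_eq_of_ne hji, hdj, zero_add]
      · rw [Finsupp.single_eq_of_ne hli, Finsupp.single_eq_of_ne hlj, add_zero]
        exact hrest' l (Finset.mem_erase.2 ⟨hlj, Finset.mem_erase.2 ⟨hli, Finset.mem_univ l⟩⟩)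
  · left
    have hrest : ∑ l ∈ Finset.univ.erase i, d l = 0 := by omega
    rw [Finset.sum_eq_zero_iff] at hrest
    refine ⟨i, Finsupp.ext fun j => ?_⟩
    by_cases hj : j = i
    · rw [hj, Finsupp.single_eq_same, hdi]
    · rw [Finsupp.single_eq_of_ne hj]
      exact hrest j (Finset.mem_erase.2 ⟨hj, Finset.mem_univ j⟩)

/-! ## 3. Evaluation at `e₀` -/

/-- For a homogeneous `P` of degree `n`, `P(e₀)` is the `p₀ⁿ`-coefficient. [folklore] -/
theorem eval_e0_eq_coeff (P : MvPolynomial (Fin 4) ℝ) (n : ℕ) (hP : P.IsHomogeneous n) :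
    MvPolynomial.eval (fun i : Fin 4 => if i = 0 then (1 : ℝ) else 0) P = MvPolynomial.coeff (Finsupp.single 0 n) P := by
  classical
  rw [MvPolynomial.eval_eq']
  have hprod : ∀ d : Fin 4 →₀ ℕ, (∏ i : Fin 4, (if i = 0 then (1 : ℝ) else 0) ^ d i) =
      if d 1 = 0 ∧ d 2 = 0 ∧ d 3 = 0 then 1 else 0 := by
    intro d
    rw [Fin.prod_univ_four]
    simp only [if_true, one_pow, one_mul, show (1 : Fin 4) ≠ 0 by decide, show (2 : Fin 4) ≠ 0 by decide,
      show (3 : Fin 4) ≠ 0 by decide, if_false]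
    by_cases h1 : d 1 = 0
    · by_cases h2 : d 2 = 0
      · by_cases h3 : d 3 = 0
        · simp [h1, h2, h3]
        · simp [h1, h2, h3, zero_pow h3]
      · simp [h1, h2, zero_pow h2]
    · simp [h1, zero_pow h1]
  simp_rw [hprod]
  rw [Finset.sum_eq_single (Finsupp.single 0 n)]
  · simp
  · intro d hd hne
    rw [if_neg, mul_zero]
    intro h
    apply hne
    have hdeg : d.degree = n := by
      by_contra hc; exact (MvPolynomial.mem_support_iff.1 hd) (hP.coeff_eq_zero hc)
    rw [Finsupp.degree_eq_sum, Fin.sum_univ_four, h.1, h.2.1, h.2.2] at hdeg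
    ext j
    fin_cases j <;> simp [h.1, h.2.1, h.2.2]; omega
  · intro h
    rw [MvPolynomial.notMem_support_iff.1 h, zero_mul]

/-! ## 4. Consequences of `W(B₄)`-invariance for homogeneous quadratics and quartics -/

/-- A `W(B₄)`-invariant homogeneous quadratic with vanishing `p₀²`-coefficient is zero. [folklore] -/
theorem quadratic_eq_zero (W : MvPolynomial (Fin 4) ℝ) (hW : W.IsHomogeneous 2)
    (hflip : ∀ ε : Fin 4 → ℝ, (∀ i, ε i = 1 ∨ ε i = -1) →
      ∀ p : Fin 4 → ℝ, MvPolynomial.eval (fun i => ε i * p i) W = MvPolynomial.eval p W)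
    (hperm : ∀ σ : Equiv.Perm (Fin 4), ∀ p : Fin 4 → ℝ, MvPolynomial.eval (fun i => p (σ i)) W = MvPolynomial.eval p W)
    (h0 : MvPolynomial.coeff (Finsupp.single 0 2) W = 0) : W = 0 := by
  classical
  ext d
  rw [MvPolynomial.coeff_zero]
  by_cases hodd : ∃ i, Odd (d i)
  · obtain ⟨i, hi⟩ := hodd
    exact coeff_eq_zero_of_odd W hflip d i hi
  · have heven : ∀ i, Even (d i) := fun i => Nat.not_odd_iff_even.1 fun h => hodd ⟨i, h⟩
    by_cases hdeg : d.degree = 2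
    · obtain ⟨i, rfl⟩ := exists_single_two d heven hdeg
      have h1 := coeff_mapDomain_perm W hperm (Equiv.swap 0 i) (Finsupp.single 0 2)
      rw [Finsupp.mapDomain_single, Equiv.swap_apply_left] at h1
      rw [h1, h0]
    · exact hW.coeff_eq_zero hdeg

/-- A `W(B₄)`-invariant homogeneous quartic with vanishing `p₀⁴`-coefficient has all its non-zero coefficients equal to the
`p₀²p₁²`-coefficient. [folklore] -/
theorem quartic_coeff_eq (W : MvPolynomial (Fin 4) ℝ) (hW : W.IsHomogeneous 4)
    (hflip : ∀ ε : Fin 4 → ℝ, (∀ i, ε i = 1 ∨ ε i = -1) →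
      ∀ p : Fin 4 → ℝ, MvPolynomial.eval (fun i => ε i * p i) W = MvPolynomial.eval p W)
    (hperm : ∀ σ : Equiv.Perm (Fin 4), ∀ p : Fin 4 → ℝ, MvPolynomial.eval (fun i => p (σ i)) W = MvPolynomial.eval p W)
    (h0 : MvPolynomial.coeff (Finsupp.single 0 4) W = 0) (d : Fin 4 →₀ ℕ) (hd : MvPolynomial.coeff d W ≠ 0) :
    MvPolynomial.coeff d W = MvPolynomial.coeff (Finsupp.single 0 2 + Finsupp.single 1 2) W := by
  classical
  have heven : ∀ i, Even (d i) := fun i =>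
    Nat.not_odd_iff_even.1 fun h => hd (coeff_eq_zero_of_odd W hflip d i h)
  have hdeg : d.degree = 4 := by
    by_contra h; exact hd (hW.coeff_eq_zero h)
  rcases shape_even_four d heven hdeg with ⟨i, rfl⟩ | ⟨i, j, hij, rfl⟩
  · exfalso
    apply hd
    have h1 := coeff_mapDomain_perm W hperm (Equiv.swap 0 i) (Finsupp.single 0 4)
    rw [Finsupp.mapDomain_single, Equiv.swap_apply_left] at h1
    rw [h1, h0]
  · set k : Fin 4 := Equiv.swap 0 i j with hk
    have hk0 : k ≠ 0 := by
      intro h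
      rw [hk, Equiv.swap_apply_eq_iff, Equiv.swap_apply_left] at h
      exact hij h.symm
    set σ : Equiv.Perm (Fin 4) := (Equiv.swap 1 k).trans (Equiv.swap 0 i) with hσ
    have hσ0 : σ 0 = i := by
      rw [hσ, Equiv.trans_apply, Equiv.swap_apply_of_ne_of_ne (by decide) hk0.symm, Equiv.swap_apply_left]
    have hσ1 : σ 1 = j := by
      rw [hσ, Equiv.trans_apply, Equiv.swap_apply_left, hk, Equiv.swap_apply_self]
    have h1 := coeff_mapDomain_perm W hperm σ (Finsupp.single 0 2 + Finsupp.single 1 2)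
    rw [Finsupp.mapDomain_add, Finsupp.mapDomain_single, Finsupp.mapDomain_single, hσ0, hσ1] at h1
    exact h1

/-! ## 5. The radiality lemma (m15) -/

/-- **`W(F₄)`-invariant quartics and `W(B₄)`-invariant quadratics are radial** (m15; Step 4 of the paper proof of 23124 — the only
place where the half-reflection is used).  The statement is the body of `Helpers.QuarticF4Radial` (HOME l15/Helpers23124d.lean) with
`IsB4Inv'` / `IsHalfInv'` unfolded. [folklore] -/
theorem quarticF4Radial :
    (∀ Z : MvPolynomial (Fin 4) ℝ, Z.IsHomogeneous 4 →
      (∀ (σ : Equiv.Perm (Fin 4)) (ε : Fin 4 → ℝ), (∀ i, ε i = 1 ∨ ε i = -1) →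
        ∀ p : Fin 4 → ℝ, MvPolynomial.eval (fun i => ε i * p (σ i)) Z = MvPolynomial.eval p Z) →
      (∀ p : Fin 4 → ℝ, MvPolynomial.eval (fun i => p i - (∑ j, p j) / 2) Z = MvPolynomial.eval p Z) →
      ∃ c : ℝ, Z = MvPolynomial.C c * (∑ i, MvPolynomial.X i ^ 2) ^ 2) ∧
    (∀ Z : MvPolynomial (Fin 4) ℝ, Z.IsHomogeneous 2 →
      (∀ (σ : Equiv.Perm (Fin 4)) (ε : Fin 4 → ℝ), (∀ i, ε i = 1 ∨ ε i = -1) →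
        ∀ p : Fin 4 → ℝ, MvPolynomial.eval (fun i => ε i * p (σ i)) Z = MvPolynomial.eval p Z) →
      ∃ c : ℝ, Z = MvPolynomial.C c * ∑ i, MvPolynomial.X i ^ 2) := by
  classical
  -- the radial polynomials are `W(B₄)`- and half-invariant
  have hsq_eval : ∀ p : Fin 4 → ℝ, MvPolynomial.eval p (∑ i : Fin 4, MvPolynomial.X i ^ 2 : MvPolynomial (Fin 4) ℝ) =
      ∑ i, p i ^ 2 := by
    intro p; simp only [map_sum, map_pow, MvPolynomial.eval_X]
  have hsq_B4 : ∀ (σ : Equiv.Perm (Fin 4)) (ε : Fin 4 → ℝ), (∀ i, ε i = 1 ∨ ε i = -1) → ∀ p : Fin 4 → ℝ,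
      (∑ i, (ε i * p (σ i)) ^ 2) = ∑ i, p i ^ 2 := by
    intro σ ε hε p
    have h1 : ∀ i, (ε i * p (σ i)) ^ 2 = p (σ i) ^ 2 := by
      intro i; rcases hε i with h | h <;> rw [h] <;> ring
    simp_rw [h1]
    exact Equiv.sum_comp σ (fun i => p i ^ 2)
  have hsq_half : ∀ p : Fin 4 → ℝ, (∑ i, (p i - (∑ j, p j) / 2) ^ 2) = ∑ i, p i ^ 2 := by
    intro p
    simp only [Fin.sum_univ_four]
    ring
  have hsq_hom : (∑ i : Fin 4, MvPolynomial.X i ^ 2 : MvPolynomial (Fin 4) ℝ).IsHomogeneous 2 :=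
    MvPolynomial.IsHomogeneous.sum _ _ _ fun i _ => MvPolynomial.isHomogeneous_X_pow i 2
  have he0sq : (∑ i : Fin 4, ((fun i : Fin 4 => if i = 0 then (1 : ℝ) else 0) i) ^ 2) = 1 := by
    simp
  -- unpacking `W(B₄)`
  have hunpack : ∀ W : MvPolynomial (Fin 4) ℝ,
      (∀ (σ : Equiv.Perm (Fin 4)) (ε : Fin 4 → ℝ), (∀ i, ε i = 1 ∨ ε i = -1) →
        ∀ p : Fin 4 → ℝ, MvPolynomial.eval (fun i => ε i * p (σ i)) W = MvPolynomial.eval p W) →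
      (∀ ε : Fin 4 → ℝ, (∀ i, ε i = 1 ∨ ε i = -1) →
        ∀ p : Fin 4 → ℝ, MvPolynomial.eval (fun i => ε i * p i) W = MvPolynomial.eval p W) ∧
      (∀ σ : Equiv.Perm (Fin 4), ∀ p : Fin 4 → ℝ,
        MvPolynomial.eval (fun i => p (σ i)) W = MvPolynomial.eval p W) := by
    intro W hBW
    refine ⟨fun ε hε p => by simpa using hBW (Equiv.refl _) ε hε p, fun σ p => ?_⟩
    simpa using hBW σ (fun _ => 1) (fun _ => Or.inl rfl) p
  constructor
  · -- (a) quartics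
    intro Z hZ hB hH
    set c : ℝ := MvPolynomial.eval (fun i : Fin 4 => if i = 0 then (1 : ℝ) else 0) Z with hc
    refine ⟨c, ?_⟩
    set R : MvPolynomial (Fin 4) ℝ := MvPolynomial.C c * (∑ i, MvPolynomial.X i ^ 2) ^ 2 with hR
    have hR_eval : ∀ p : Fin 4 → ℝ, MvPolynomial.eval p R = c * (∑ i, p i ^ 2) ^ 2 := by
      intro p; rw [hR, map_mul, MvPolynomial.eval_C, map_pow, hsq_eval]
    have hR_hom : R.IsHomogeneous 4 := by
      have := (hsq_hom.pow 2).C_mul c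
      simpa [hR] using this
    set W : MvPolynomial (Fin 4) ℝ := Z - R with hWdef
    have hW : W.IsHomogeneous 4 := hZ.sub hR_hom
    have hBW : ∀ (σ : Equiv.Perm (Fin 4)) (ε : Fin 4 → ℝ), (∀ i, ε i = 1 ∨ ε i = -1) →
        ∀ p : Fin 4 → ℝ, MvPolynomial.eval (fun i => ε i * p (σ i)) W = MvPolynomial.eval p W := by
      intro σ ε hε p
      rw [hWdef, map_sub, map_sub, hB σ ε hε p, hR_eval, hR_eval, hsq_B4 σ ε hε p]
    have hHW : ∀ p : Fin 4 → ℝ, MvPolynomial.eval (fun i => p i - (∑ j, p j) / 2) W = MvPolynomial.eval p W := by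
      intro p
      rw [hWdef, map_sub, map_sub, hH p, hR_eval, hR_eval, hsq_half p]
    obtain ⟨hflip, hperm⟩ := hunpack W hBW
    have he0W : MvPolynomial.eval (fun i : Fin 4 => if i = 0 then (1 : ℝ) else 0) W = 0 := by
      rw [hWdef, map_sub, hR_eval, he0sq, ← hc]; ring
    have h0 : MvPolynomial.coeff (Finsupp.single 0 4) W = 0 := by rw [← eval_e0_eq_coeff W 4 hW, he0W]
    set β : ℝ := MvPolynomial.coeff (Finsupp.single 0 2 + Finsupp.single 1 2) W with hβ
    have hstruct := quartic_coeff_eq W hW hflip hperm h0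
    by_cases hβ0 : β = 0
    · -- all coefficients vanish
      have hW0 : W = 0 := by
        ext d
        rw [MvPolynomial.coeff_zero]
        by_contra h
        exact h ((hstruct d h).trans hβ0)
      rw [hWdef, sub_eq_zero] at hW0
      exact hW0
    · -- the half-reflection at `e₀` sees the mixed coefficients
      exfalso
      have hpt : (fun i : Fin 4 => (fun j : Fin 4 => if j = 0 then (1 : ℝ) else 0) i -
          (∑ j, (fun j : Fin 4 => if j = 0 then (1 : ℝ) else 0) j) / 2) =
          (1 / 2 : ℝ) • (fun i : Fin 4 => if i = 0 then (1 : ℝ) else -1) := by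
        funext i
        simp only [Fin.sum_univ_four, Pi.smul_apply, smul_eq_mul, if_true, show (1 : Fin 4) ≠ 0 by decide,
          show (2 : Fin 4) ≠ 0 by decide, show (3 : Fin 4) ≠ 0 by decide, if_false]
        split_ifs <;> norm_num
      have h1 := hHW (fun j : Fin 4 => if j = 0 then (1 : ℝ) else 0)
      rw [he0W, hpt, eval_smul_of_isHomogeneous W hW] at h1
      have h2 : MvPolynomial.eval (fun i : Fin 4 => if i = 0 then (1 : ℝ) else -1) W =
          MvPolynomial.eval (fun _ : Fin 4 => (1 : ℝ)) W := by
        have := hflip (fun i : Fin 4 => if i = 0 then (1 : ℝ) else -1)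
          (fun i => by by_cases hi : i = 0 <;> simp [hi]) (fun _ => 1)
        simpa only [mul_one] using this
      have h3 : MvPolynomial.eval (fun _ : Fin 4 => (1 : ℝ)) W = (W.support.card : ℝ) * β := by
        rw [MvPolynomial.eval_eq']
        simp only [one_pow, Finset.prod_const_one, mul_one]
        rw [Finset.sum_congr rfl fun d hd => hstruct d (MvPolynomial.mem_support_iff.1 hd), Finset.sum_const,
          nsmul_eq_mul]
      have hcard : 0 < W.support.card := Finset.card_pos.2 ⟨_, MvPolynomial.mem_support_iff.2 hβ0⟩
      rw [h2, h3] at h1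
      have : ((1 / 2 : ℝ)) ^ 4 * ((W.support.card : ℝ) * β) ≠ 0 :=
        mul_ne_zero (by norm_num) (mul_ne_zero (by exact_mod_cast hcard.ne') hβ0)
      exact this h1
  · -- (b) quadratics
    intro Z hZ hB
    set c : ℝ := MvPolynomial.eval (fun i : Fin 4 => if i = 0 then (1 : ℝ) else 0) Z with hc
    refine ⟨c, ?_⟩
    set R : MvPolynomial (Fin 4) ℝ := MvPolynomial.C c * ∑ i, MvPolynomial.X i ^ 2 with hR
    have hR_eval : ∀ p : Fin 4 → ℝ, MvPolynomial.eval p R = c * ∑ i, p i ^ 2 := by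
      intro p; rw [hR, map_mul, MvPolynomial.eval_C, hsq_eval]
    have hR_hom : R.IsHomogeneous 2 := hsq_hom.C_mul c
    set W : MvPolynomial (Fin 4) ℝ := Z - R with hWdef
    have hW : W.IsHomogeneous 2 := hZ.sub hR_hom
    have hBW : ∀ (σ : Equiv.Perm (Fin 4)) (ε : Fin 4 → ℝ), (∀ i, ε i = 1 ∨ ε i = -1) →
        ∀ p : Fin 4 → ℝ, MvPolynomial.eval (fun i => ε i * p (σ i)) W = MvPolynomial.eval p W := by
      intro σ ε hε p
      rw [hWdef, map_sub, map_sub, hB σ ε hε p, hR_eval, hR_eval, hsq_B4 σ ε hε p]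
    obtain ⟨hflip, hperm⟩ := hunpack W hBW
    have he0W : MvPolynomial.eval (fun i : Fin 4 => if i = 0 then (1 : ℝ) else 0) W = 0 := by
      rw [hWdef, map_sub, hR_eval, he0sq, ← hc]; ring
    have h0 : MvPolynomial.coeff (Finsupp.single 0 2) W = 0 := by rw [← eval_e0_eq_coeff W 2 hW, he0W]
    have hW0 := quadratic_eq_zero W hW hflip hperm h0
    rw [hWdef, sub_eq_zero] at hW0
    exact hW0

end Summit.QuantumFields.YangMills.Theorems.RationalShortRootRigidity
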